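/-
COR-CM (cells pub-hodgecm / pub-hodgecm2, stage 2 of the Hodge ladder) — TRANSPOSITION item (vi), S-LANE CARRIERS-PLAN step S7 (first
re-cut): the integrated ROUTE-(B) END display of `Transposition/Item6SupplyPinnedAssemblyAlongHolds.lean` (p311451 ✔, §1 :113 / §3 :250)
with Liu's §4.2 datum `R` NO LONGER POSITED WHOLE but BUILT as s2crux-idea-1's ONE-OBJECT REST `restOne` (`Liu2021/AppendixC/RestOne.lean`,
CARRIERS-PLAN S1: REAL `Obj` / `A_μ` / `Ω(μ)` / `res` / `res_pull`) at own-htheta's CHOSEN CHARACTER `μ(Φ, ι₁) = muOfInvType ι₁ Φ`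
(`Transposition/Item6MuOfInverseType.lean`, CARRIERS-PLAN S2 μ-part: REAL `μ`, conjugate symplectic, weight one, `Φ_μ = Φ^{*ι₁}`).  EFFECT ON
THE DISPLAYED HYPOTHESES of p311451 §3 (15): `hμ` (row 11) DELETED — a theorem (`thm418Data_comp_mem_cmType_iff_of_mu_eq`); `i`, `hdim`,
`hdet45` (rows 12–14) DELETED — projections `iOne` / `hdimOne` / `hdet45One` of the chosen Def. 4.5 (2) datum; `hObj` (row 7) becomes
LITERALLY [Liu2021] Prop. 4.6 (1) «`𝒜(μ)` is nonempty» over the honest object type `Def45.CMDatum` (`nonempty_obj_restOne_iff`); `hChi`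
(row 8) becomes `Nonempty (Chi …)` on the posited character carrier.  What is posited INSTEAD of the whole `R`: exactly its non-CM fields —
the Def. 4.5 (2) token `P` = the pairs `(λ_μ, r_μ)` of bullets 3–4 (bullet 2, the CM character, is the REAL tree predicate `IsCMCharacterMuAlgHecke` through `Def45.Carriers.ofPolDR`, pin-2 g2ʼs design word), the index carriers `Eps`/`epsOf`/`Chi` (Def. 4.11–4.12; CARRIERS-PLAN S2
remainder), the local-theta modules `omega`/`rho` (Def. 4.11; S3) and the Hecke action `rhoΩ` on `Ω(μ)` (l. 2219; S6 = (U7)).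
pin-3 = prover-pub-hodgecm2-pin-3-g3-0 (S7 owner per CARRIERS-PLAN.md v1.1 §4; S2 co-owner with own-htheta g4).  Theorems only: no
definition, no instance, no named fact, no `variable`, no proof holes; nothing landed is edited or restated (NEW path, FILE-ONCE).
FRAMING: HC_CM is NOT proved; S2 = B01-S is NOT inhabited by this file; NOT claimed: that Liu's `X_K`/`A_K`/`ω`/Hecke action are
constructed — `iso`, `C`, `P`, `Eps`, `epsOf`, `Chi`, `omega`, `rho`, `rhoΩ` are POSITED, `h`/`hA`/`hLiu`/`hObj`/`hChi`/`hirr`/`hsm`/`hM`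
are HYPOTHESES.  RED-TEAM WATCH (TGTBT D18.3 item 1, tgtbt-1 g20): `P` is a FREE token family — the theorem holds for every `P`; at a `P`
whose fibres `P A i` are inhabited for pairs `(A, i)` carrying NO compatible polarisation / de Rham pair (ll. 1955–1958) the object type
`Def45.CMDatum … (Carriers.ofPolDR μ P)` may exceed Liu's `𝒜(μ)`, and `hLiu`/`hObj` at such a `P` read «[Liu2021] Thm. 4.18 / Prop. 4.6 (1) +
l. 1982 ([Shi71] Thm. 5: `λ_μ` exists; `r_μ` «obvious») for that `(A, i)`»; the honest pin is a `P` carrying the printed predicate.  The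
classification of the reading is the plan writer's / red team's (CARRIERS-PLAN row 6), not this file's.
-/
import Summits.HodgeConjecture.CorCM.B01.Transposition.Item6SupplyPinnedAssemblyAlongHolds
import Summits.HodgeConjecture.CorCM.B01.Transposition.Item6MuOfInverseType
import Literature.NumberTheory.Automorphic.Liu2021.AppendixC.RestOne
import Literature.NumberTheory.Automorphic.Liu2021.Def45CMCharacter
import HarnessLib

set_option autoImplicit false

/-!
# B01-S and the (β)-free END display at `R := restOne … (μ := μ(Φ, ι₁))` — CARRIERS-PLAN S7, first re-cut

For every face datum `(F, ι₁, V, Φ)` with `F` Galois the §4.2 rest is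
`restOne (C F ι₁ V Φ) (AlgHom.id ℚ F) ι₁ (isConjugateSymplectic_muOfInvType ι₁ Φ) (hasWeight_one_muOfInvType ι₁ Φ) (Def45.Carriers.ofPolDR (muOfInvType ι₁ Φ) (P F ι₁ V Φ))
  (Eps F ι₁ V Φ) (epsOf F ι₁ V Φ) (Chi F ι₁ V Φ) (omega F ι₁ V Φ) (rho F ι₁ V Φ) (rhoΩ F ι₁ V Φ)`
— presentation `(L, φ, ι) := (F, id, ι₁)` of `M'_μ ⊆ ℂ` ([Liu2021] Def. 4.3 (2)), legitimate because the face guard makes `F/ℚ` Galois.  The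
landed junction `faceSupply_of_thm418AsPrinted_glue_unif_along` (p303619 :140) wants an UNGUARDED family `R : ∀ F ι₁ V Φ, Thm418Rest (C F ι₁ V Φ)`
while `restOne`/`muOfInvType` need `[IsGalois ℚ F]`; inside the proof the family is therefore `restOne …` on the Galois branch and an inert
rest (empty object and character types) elsewhere — never read, since EVERY hypothesis of the junction is guarded by `IsGalois ℚ F` — and each
guarded hypothesis is moved across `dif_pos` by `rw`.  The CM half is hcmisog-isog-2's σ-parametric Core theorem at `σ := ῑ₁` exactly as in
p311451 §1, now fed with the PROJECTIONS `iOne`/`hdimOne`/`hdet45One` of the chosen datum (s2crux-idea-1) and `Def45.eta_starRingEnd_comp_apply`;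
the choice binder is own-htheta's theorem `thm418Data_comp_mem_cmType_iff_of_mu_eq … rfl` through tr-prover-2's `isInverse_starRingEnd_comp_iff`.
HC_CM is NOT proved.

References: Y. Liu, arXiv:2102.11518 = Camb. J. Math. 9 (2021) (`FJcycle.tex` md5 6db49a74122d): Def. 4.1 l. 1901, Def. 4.3 l. 1917–1928,
Def. 4.5 l. 1936–1964, Prop. 4.6 (1) l. 1969, §4.2 l. 2053–2076, Def. 4.11–4.12 l. 2083–2108, Def. 4.16–Rem. 4.17 l. 2219–2227, Thm. 4.18
l. 2232–2245, App. C l. 4583–4637.  P. Deligne, *Variétés de Shimura* (Corvallis 1979) §2.1.2, 2.2.5.  A. Weil, *Basic Number Theory* (1967)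
Ch. VII §3.
-/

noncomputable section

open scoped TensorProduct InnerProductSpace

namespace Summit.HodgeConjecture.CorCM.Model

open CategoryTheory CategoryTheory.Limits AlgebraicGeometry NumberField
open Literature.AlgebraicGeometry.Motives
open Literature.AlgebraicGeometry.HodgeTheory
open Literature.AlgebraicGeometry.ShimuraVarieties
open Literature.AlgebraicGeometry.ShimuraVarieties.UnitaryCanonicalModel
open Literature.AlgebraicGeometry.ComplexMultiplication (IsCMTypeRealisation)
open Literature.NumberTheory.ComplexMultiplication
open Literature.NumberTheory.Automorphic
open Literature.NumberTheory.Automorphic.IdeleClassGroup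
open Literature.NumberTheory.Automorphic.PicardCM
open Literature.NumberTheory.Automorphic.Liu2021
open Literature.NumberTheory.Automorphic.Liu2021.AppendixC
open Literature.NumberTheory.Automorphic.Liu2021.AppendixC.RestOne
open Summit.HodgeConjecture.CorCM.Transposition

/-! ## §1  B01-S at the one-object rest of the chosen character -/

/-- **B01-S from [Liu 2021, Thm. 4.18] AS PRINTED at the APPENDIX-C DATUM OF RECORD with the §4.2 rest BUILT as `restOne` at `μ(Φ, ι₁)`**
(`P5 := honestP5Of h`, pin `A_μ ⊗_{F,ῑ₁} ℂ`, `U = picardCMUniverse hHD hI h₁ h₃`): p303619's `faceSupply_of_thm418AsPrinted_glue_unif_along` at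
`e := fun _ ι₁ ↦ ῑ₁`, `P5 := honestP5Of h`, `R F ι₁ V Φ := restOne (C …) id ι₁ (μ := muOfInvType ι₁ Φ) (Carriers.ofPolDR _ (P …)) (Eps …) … (rhoΩ …)` on Galois `F`,
with `hUnif := hUnif_holds h`, `hAlb := hAlb_holds hA …` [TEAM hComp] and the CM half from `iOne`/`hdimOne`/`hdet45One` [hcmisog-isog-2 Core
theorem; s2crux-idea-1 projections], the choice from `thm418Data_comp_mem_cmType_iff_of_mu_eq` [own-htheta].  Displayed hypotheses: the cites
`h` ([Deligne1979] 2.1.2/2.2.5) and `hA` ([Liu2021] §2.1 + [FGA]); the POSITED carriers `iso`, `C` (§4.2 / App. C), `P` (Def. 4.5 (2) bullets 3–4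
`(λ_μ, r_μ)`, token — bullet 2 is REAL: `Carriers.ofPolDR`, `IsCMCharacterMuAlgHecke`), `Eps`/`epsOf`/`Chi` (Def. 4.11–4.12), `omega`/`rho` (Def. 4.11 `ω(μ,ε,χ)` with its `𝔾(𝔸_F^∞)`-action), `rhoΩ` (POSITED `𝔾(𝔸_F^∞)`-action on
`Ω(μ)`; it equals the printed Hecke action of l. 2219 only under S6/(U7), `AppendixC/RestOneHecke`); THE CITE `hLiu` (Thm. 4.18 l. 2232–2245, read at this
rest: its main clause is asked at the posited `rhoΩ`; on the OBJECT quantifier of item (1) it is ≤ print — one chosen object —, and at a free `P`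
its cite class is «as printed + l. 1982», see the module header); `hObj` = Prop. 4.6 (1) «`𝒜(μ)` nonempty» (l. 1969) VERBATIM over `Def45.CMDatum … (Carriers.ofPolDR …)` = b25ʼs S4 (c) target type at `μ := μ(Φ, ι₁)`; `hChi` (a character exists); `hirr`/`hsm`
(Def. 4.11 «irreducible admissible», l. 2092–2096; [Liu2021] Lem. D.1 (1)).  NO `hμ`, `i`, `hdim`, `hdet45`, `R` binder.  HC_CM is NOT
proved; none of the hypotheses is inhabited here; `restOne` constructs `Obj`/`A_μ`/`Ω`/`res` only.
[cite: Liu2021, Thm. 4.18 (FJcycle.tex l. 2232–2245), Prop. 4.6 (1) (l. 1969), Def. 4.5 (2) (l. 1944–1958), Def. 4.11–4.12 (l. 2083–2108), Def. 4.16–Rem. 4.17 (l. 2219–2227), §4.2 l. 2053–2074 and Prop. C.5 (l. 4627–4637)]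
[cite: Deligne1979ShimuraVarieties, §2.1.2 and 2.2.5] -/
theorem faceSupply_of_thm418AsPrinted_along_conj_holds_restOne
    (hHD : exists_isReal_hodgeModel) (hI : hodgePQ_independent_of_hodgeModel)
    (h₁ : BallQuotientUniformised) (h₃ : CMAbelianVarietyRealised)
    (h : exists_recordSystem) (hA : albanese_baseChange_isLimit_fan_jacobian)
    (iso : ∀ (F : CMField) (ι₁ : F →+* ℂ) (_ : HermSpace3 F ι₁) (_ : CMType F), ℕ → Prop)
    (C : ∀ (F : CMField) (ι₁ : F →+* ℂ) (V : HermSpace3 F ι₁) (Φ : CMType F), Sec42Data (honestP5Of h F ι₁ V Φ) (iso F ι₁ V Φ))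
    (P : ∀ (F : CMField) [IsGalois ℚ F] (ι₁ : F →+* ℂ) (_ : HermSpace3 F ι₁) (Φ : CMType F) (A : AbelianVariety F),
      (muAlgValueField F (muOfInvType ι₁ Φ) →+* A.endAlgebra) → Type)
    (Eps : ∀ (F : CMField) (ι₁ : F →+* ℂ) (_ : HermSpace3 F ι₁) (_ : CMType F), Type)
    (epsOf : ∀ (F : CMField) (ι₁ : F →+* ℂ) (V : HermSpace3 F ι₁) (Φ : CMType F), F → Eps F ι₁ V Φ)
    (Chi : ∀ (F : CMField) (ι₁ : F →+* ℂ) (_ : HermSpace3 F ι₁) (_ : CMType F), Type)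
    (omega : ∀ (F : CMField) (ι₁ : F →+* ℂ) (V : HermSpace3 F ι₁) (Φ : CMType F), Eps F ι₁ V Φ → Chi F ι₁ V Φ → Type)
    [instACG : ∀ (F : CMField) (ι₁ : F →+* ℂ) (V : HermSpace3 F ι₁) (Φ : CMType F) (ε : Eps F ι₁ V Φ) (χ : Chi F ι₁ V Φ),
      AddCommGroup (omega F ι₁ V Φ ε χ)]
    [instMod : ∀ (F : CMField) (ι₁ : F →+* ℂ) (V : HermSpace3 F ι₁) (Φ : CMType F) (ε : Eps F ι₁ V Φ) (χ : Chi F ι₁ V Φ),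
      Module ℂ (omega F ι₁ V Φ ε χ)]
    (rho : ∀ (F : CMField) (ι₁ : F →+* ℂ) (V : HermSpace3 F ι₁) (Φ : CMType F) (ε : Eps F ι₁ V Φ) (χ : Chi F ι₁ V Φ),
      Representation ℂ (C F ι₁ V Φ).G (omega F ι₁ V Φ ε χ))
    (rhoΩ : ∀ (F : CMField) [IsGalois ℚ F] (ι₁ : F →+* ℂ) (V : HermSpace3 F ι₁) (Φ : CMType F),
      Representation (fieldOfValues F (muOfInvType ι₁ Φ)) (C F ι₁ V Φ).G
        (ΩOne (C F ι₁ V Φ) (AlgHom.id ℚ F) ι₁ (isConjugateSymplectic_muOfInvType ι₁ Φ) (hasWeight_one_muOfInvType ι₁ Φ) (Def45.Carriers.ofPolDR (muOfInvType ι₁ Φ) (P F ι₁ V Φ))))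
    (hLiu : ∀ (F : CMField) [IsGalois ℚ F], 6 ≤ Module.finrank ℚ F → ∀ (Φ : CMType F) (ι₁ : F →+* ℂ), ι₁ ∈ Φ.1 →
      ∀ V : HermSpace3 F ι₁, Thm418AsPrintedC (C F ι₁ V Φ)
        (restOne (C F ι₁ V Φ) (AlgHom.id ℚ F) ι₁ (isConjugateSymplectic_muOfInvType ι₁ Φ) (hasWeight_one_muOfInvType ι₁ Φ) (Def45.Carriers.ofPolDR (muOfInvType ι₁ Φ) (P F ι₁ V Φ))
          (Eps F ι₁ V Φ) (epsOf F ι₁ V Φ) (Chi F ι₁ V Φ) (omega F ι₁ V Φ) (rho F ι₁ V Φ) (rhoΩ F ι₁ V Φ)))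
    (hObj : ∀ (F : CMField) [IsGalois ℚ F], 6 ≤ Module.finrank ℚ F → ∀ (Φ : CMType F) (ι₁ : F →+* ℂ), ι₁ ∈ Φ.1 →
      ∀ V : HermSpace3 F ι₁,
        Nonempty (Def45.CMDatum (AlgHom.id ℚ F) ι₁ (isConjugateSymplectic_muOfInvType ι₁ Φ) (hasWeight_one_muOfInvType ι₁ Φ) (Def45.Carriers.ofPolDR (muOfInvType ι₁ Φ) (P F ι₁ V Φ))))
    (hChi : ∀ (F : CMField), IsGalois ℚ F → 6 ≤ Module.finrank ℚ F → ∀ (Φ : CMType F) (ι₁ : F →+* ℂ), ι₁ ∈ Φ.1 →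
      ∀ V : HermSpace3 F ι₁, Nonempty (Chi F ι₁ V Φ))
    (hirr : ∀ (F : CMField) [IsGalois ℚ F], 6 ≤ Module.finrank ℚ F → ∀ (Φ : CMType F) (ι₁ : F →+* ℂ), ι₁ ∈ Φ.1 →
      ∀ (V : HermSpace3 F ι₁)
        (i : (toThm418Data (C F ι₁ V Φ)
          (restOne (C F ι₁ V Φ) (AlgHom.id ℚ F) ι₁ (isConjugateSymplectic_muOfInvType ι₁ Φ) (hasWeight_one_muOfInvType ι₁ Φ) (Def45.Carriers.ofPolDR (muOfInvType ι₁ Φ) (P F ι₁ V Φ))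
            (Eps F ι₁ V Φ) (epsOf F ι₁ V Φ) (Chi F ι₁ V Φ) (omega F ι₁ V Φ) (rho F ι₁ V Φ) (rhoΩ F ι₁ V Φ))).AdmIndex),
        (rho F ι₁ V Φ i.1.1 i.1.2).IsIrreducible)
    (hsm : ∀ (F : CMField) [IsGalois ℚ F], 6 ≤ Module.finrank ℚ F → ∀ (Φ : CMType F) (ι₁ : F →+* ℂ), ι₁ ∈ Φ.1 →
      ∀ (V : HermSpace3 F ι₁)
        (i : (toThm418Data (C F ι₁ V Φ)
          (restOne (C F ι₁ V Φ) (AlgHom.id ℚ F) ι₁ (isConjugateSymplectic_muOfInvType ι₁ Φ) (hasWeight_one_muOfInvType ι₁ Φ) (Def45.Carriers.ofPolDR (muOfInvType ι₁ Φ) (P F ι₁ V Φ))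
            (Eps F ι₁ V Φ) (epsOf F ι₁ V Φ) (Chi F ι₁ V Φ) (omega F ι₁ V Φ) (rho F ι₁ V Φ) (rhoΩ F ι₁ V Φ))).AdmIndex)
        (v : omega F ι₁ V Φ i.1.1 i.1.2),
        ∃ S : Subgroup (C F ι₁ V Φ).G, IsOpen (S : Set (C F ι₁ V Φ).G) ∧ ∀ k ∈ S, rho F ι₁ V Φ i.1.1 i.1.2 k v = v) :
    (picardCMUniverse hHD hI h₁ h₃).FaceSupply := by
  classical
  -- THE CARRIER FAMILY fed to the unguarded junction: `restOne …` on the Galois branch; on the other branch an inert rest with EMPTY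
  -- object and character types (never read: every hypothesis of the junction is guarded by `IsGalois ℚ F`)
  let R : ∀ (F : CMField) (ι₁ : F →+* ℂ) (V : HermSpace3 F ι₁) (Φ : CMType F), Thm418Rest (C F ι₁ V Φ) := fun F ι₁ V Φ =>
    if hG : IsGalois ℚ F then
      restOne (C F ι₁ V Φ) (AlgHom.id ℚ F) ι₁ (isConjugateSymplectic_muOfInvType ι₁ Φ) (hasWeight_one_muOfInvType ι₁ Φ) (Def45.Carriers.ofPolDR (muOfInvType ι₁ Φ) (P F ι₁ V Φ))
        (Eps F ι₁ V Φ) (epsOf F ι₁ V Φ) (Chi F ι₁ V Φ) (omega F ι₁ V Φ) (rho F ι₁ V Φ) (rhoΩ F ι₁ V Φ)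
    else
      { Eps := PUnit
        epsOf := fun _ => PUnit.unit
        Chi := PEmpty
        μ := (exists_isConjugateSymplectic_hasCMType (L := F) Φ).choose
        isConjugateSymplectic := (exists_isConjugateSymplectic_hasCMType (L := F) Φ).choose_spec.1
        hasWeight_one := (exists_isConjugateSymplectic_hasCMType (L := F) Φ).choose_spec.2.1
        Obj := PEmpty
        Aμ := fun D => D.elim
        omega := fun _ χ => χ.elim
        instAddCommGroupOmega := fun _ χ => χ.elim
        instModuleOmega := fun _ χ => χ.elim
        rho := fun _ χ => χ.elim
        Ω := PUnit
        rhoΩ := 1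
        res := fun _ D => D.elim
        res_pull := fun _ D => D.elim }
  have hR : ∀ (F : CMField) [hG : IsGalois ℚ F] (ι₁ : F →+* ℂ) (V : HermSpace3 F ι₁) (Φ : CMType F), R F ι₁ V Φ =
      restOne (C F ι₁ V Φ) (AlgHom.id ℚ F) ι₁ (isConjugateSymplectic_muOfInvType ι₁ Φ) (hasWeight_one_muOfInvType ι₁ Φ) (Def45.Carriers.ofPolDR (muOfInvType ι₁ Φ) (P F ι₁ V Φ))
        (Eps F ι₁ V Φ) (epsOf F ι₁ V Φ) (Chi F ι₁ V Φ) (omega F ι₁ V Φ) (rho F ι₁ V Φ) (rhoΩ F ι₁ V Φ) :=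
    fun F hG ι₁ V Φ => dif_pos hG
  refine faceSupply_of_thm418AsPrinted_glue_unif_along hHD hI h₁ h₃ (fun _ ι₁ => (starRingEnd ℂ).comp ι₁) (honestP5Of h) iso C R
    ?_ ?_ ?_ ?_ ?_ ?_ ?_ (hUnif_holds h) (hAlb_holds hA (fun _ ι₁ => (starRingEnd ℂ).comp ι₁) (honestP5Of h) iso C)
  -- THE CITE, Thm. 4.18 as printed, at the rest
  · intro F hG h6 Φ ι₁ hι V
    rw [hR]
    exact hLiu F h6 Φ ι₁ hι V
  -- Prop. 4.6 (1) «nonempty», through s2crux-idea-1's `nonempty_obj_restOne_iff`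
  · intro F hG h6 Φ ι₁ hι V
    rw [hR]
    exact (nonempty_obj_restOne_iff (C F ι₁ V Φ) (AlgHom.id ℚ F) ι₁ (isConjugateSymplectic_muOfInvType ι₁ Φ)
      (hasWeight_one_muOfInvType ι₁ Φ) (Def45.Carriers.ofPolDR (muOfInvType ι₁ Φ) (P F ι₁ V Φ)) (Eps F ι₁ V Φ) (epsOf F ι₁ V Φ) (Chi F ι₁ V Φ) (omega F ι₁ V Φ)
      (rho F ι₁ V Φ) (rhoΩ F ι₁ V Φ)).mpr (hObj F h6 Φ ι₁ hι V)
  -- a character exists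
  · intro F hG h6 Φ ι₁ hι V
    rw [hR]
    exact hChi F hG h6 Φ ι₁ hι V
  -- «irreducible»
  · intro F hG h6 Φ ι₁ hι V
    rw [hR]
    exact hirr F h6 Φ ι₁ hι V
  -- «admissible» (smooth vectors)
  · intro F hG h6 Φ ι₁ hι V
    rw [hR]
    exact hsm F h6 Φ ι₁ hι V
  -- THE CHOICE `Φ_μ = Φ^{*ι₁}` read at `ῑ₁`: own-htheta's theorem for `μ := μ(Φ, ι₁)` (the rest's `μ`, by `rfl`), through tr-prover-2's
  -- `isInverse_starRingEnd_comp_iff`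
  · intro F hG h6 Φ ι₁ hι V
    rw [hR]
    exact (Transposition.isInverse_starRingEnd_comp_iff ι₁ Φ _).mpr fun g =>
      thm418Data_comp_mem_cmType_iff_of_mu_eq _ ι₁ Φ rfl g
  -- THE CM HALF: hcmisog-isog-2's σ-parametric Core theorem at `σ := ῑ₁` with the PROJECTIONS of the chosen Def. 4.5 (2) datum, and the
  -- first bullet moved from `ῑ₁` to `ι₁` by `Def45.eta_starRingEnd_comp_apply`
  · intro F hG h6 Φ ι₁ hι V
    rw [hR]
    intro Dμ incl hincl
    exact exists_isogeny_isCMTypeRealisation_baseChange_of_det45 cotangent_hodge10_comparison_holds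
      (fun _ _ L _ _ _ u => AbelianVariety.det_cotangentMap_baseChange L u)
      ((starRingEnd ℂ).comp ι₁) (isConjugateSymplectic_muOfInvType ι₁ Φ)
      (AμOne (AlgHom.id ℚ F) ι₁ (isConjugateSymplectic_muOfInvType ι₁ Φ) (hasWeight_one_muOfInvType ι₁ Φ) (Def45.Carriers.ofPolDR (muOfInvType ι₁ Φ) (P F ι₁ V Φ)) Dμ)
      (iOne (AlgHom.id ℚ F) ι₁ (isConjugateSymplectic_muOfInvType ι₁ Φ) (hasWeight_one_muOfInvType ι₁ Φ) (Def45.Carriers.ofPolDR (muOfInvType ι₁ Φ) (P F ι₁ V Φ)) Dμ)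
      (hdimOne (AlgHom.id ℚ F) ι₁ (isConjugateSymplectic_muOfInvType ι₁ Φ) (hasWeight_one_muOfInvType ι₁ Φ) (Def45.Carriers.ofPolDR (muOfInvType ι₁ Φ) (P F ι₁ V Φ)) Dμ)
      (fun x M f hM hx => by
        rw [Def45.eta_starRingEnd_comp_apply]
        exact hdet45One (AlgHom.id ℚ F) ι₁ (isConjugateSymplectic_muOfInvType ι₁ Φ) (hasWeight_one_muOfInvType ι₁ Φ) (Def45.Carriers.ofPolDR (muOfInvType ι₁ Φ) (P F ι₁ V Φ))
          Dμ x M f hM hx)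
      incl hincl

/-! ## §2  THE (β)-FREE END DISPLAY, MEETING FORM, on the universe of record, at the one-object rest -/

section MeetingForm

open MeasureTheory
open Prior.Perl34File (Perl34.IsolationSetting)
open Prior.Perl34File.Perl34

/-- **END DISPLAY, (β)-FREE MEETING FORM, on the universe OF RECORD, at `R := restOne … (μ := μ(Φ, ι₁))`** (`let U := U_rec`): §1 composed
BY NAME with `hc_cm_of_supply_of_settingMeetSat_embOf` (`B01/FaceWedgeOverlapBypassMeeting.lean` at the four `_holds` data and
`deligneMilne1982_Thm_6_20_full_holds`), exactly as p311451 §3 :250.  Displayed hypotheses = the §1 binders {`h`, `hA` (cites); `iso`, `C`, `P`,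
`Eps`, `epsOf`, `Chi`, `omega` (+ its two instance families), `rho`, `rhoΩ` (posited carriers); `hLiu`, `hObj`, `hChi`, `hirr`, `hsm` (readings)}
+ the theta-side meeting binder `hM` (b01-x2's text VERBATIM at `U_rec`).  Compared with p311451 §3: `R` ↦ {`P`, `Eps`, `epsOf`, `Chi`, `omega`,
`rho`, `rhoΩ`} (its non-CM fields, individually), `hμ`/`i`/`hdim`/`hdet45` GONE, `hObj` = Prop. 4.6 (1) verbatim.  HC_CM is NOT proved: no
hypothesis is inhabited here.
[cite: Liu2021, Thm. 4.18 (FJcycle.tex l. 2232–2245), Prop. 4.6 (1) (l. 1969), Def. 4.5 (2) (l. 1944–1958), Def. 4.11–4.12 (l. 2083–2108), §4.2 l. 2053–2074 and Prop. C.5 (l. 4627–4637)]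
[cite: Deligne1979ShimuraVarieties, §2.1.2 and 2.2.5] -/
theorem hc_cm_of_thm418AsPrinted_along_conj_holds_restOne_meeting_rec
    (h : exists_recordSystem) (hA : albanese_baseChange_isLimit_fan_jacobian)
    (iso : ∀ (F : CMField) (ι₁ : F →+* ℂ) (_ : HermSpace3 F ι₁) (_ : CMType F), ℕ → Prop)
    (C : ∀ (F : CMField) (ι₁ : F →+* ℂ) (V : HermSpace3 F ι₁) (Φ : CMType F), Sec42Data (honestP5Of h F ι₁ V Φ) (iso F ι₁ V Φ))
    (P : ∀ (F : CMField) [IsGalois ℚ F] (ι₁ : F →+* ℂ) (_ : HermSpace3 F ι₁) (Φ : CMType F) (A : AbelianVariety F),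
      (muAlgValueField F (muOfInvType ι₁ Φ) →+* A.endAlgebra) → Type)
    (Eps : ∀ (F : CMField) (ι₁ : F →+* ℂ) (_ : HermSpace3 F ι₁) (_ : CMType F), Type)
    (epsOf : ∀ (F : CMField) (ι₁ : F →+* ℂ) (V : HermSpace3 F ι₁) (Φ : CMType F), F → Eps F ι₁ V Φ)
    (Chi : ∀ (F : CMField) (ι₁ : F →+* ℂ) (_ : HermSpace3 F ι₁) (_ : CMType F), Type)
    (omega : ∀ (F : CMField) (ι₁ : F →+* ℂ) (V : HermSpace3 F ι₁) (Φ : CMType F), Eps F ι₁ V Φ → Chi F ι₁ V Φ → Type)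
    [instACG : ∀ (F : CMField) (ι₁ : F →+* ℂ) (V : HermSpace3 F ι₁) (Φ : CMType F) (ε : Eps F ι₁ V Φ) (χ : Chi F ι₁ V Φ),
      AddCommGroup (omega F ι₁ V Φ ε χ)]
    [instMod : ∀ (F : CMField) (ι₁ : F →+* ℂ) (V : HermSpace3 F ι₁) (Φ : CMType F) (ε : Eps F ι₁ V Φ) (χ : Chi F ι₁ V Φ),
      Module ℂ (omega F ι₁ V Φ ε χ)]
    (rho : ∀ (F : CMField) (ι₁ : F →+* ℂ) (V : HermSpace3 F ι₁) (Φ : CMType F) (ε : Eps F ι₁ V Φ) (χ : Chi F ι₁ V Φ),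
      Representation ℂ (C F ι₁ V Φ).G (omega F ι₁ V Φ ε χ))
    (rhoΩ : ∀ (F : CMField) [IsGalois ℚ F] (ι₁ : F →+* ℂ) (V : HermSpace3 F ι₁) (Φ : CMType F),
      Representation (fieldOfValues F (muOfInvType ι₁ Φ)) (C F ι₁ V Φ).G
        (ΩOne (C F ι₁ V Φ) (AlgHom.id ℚ F) ι₁ (isConjugateSymplectic_muOfInvType ι₁ Φ) (hasWeight_one_muOfInvType ι₁ Φ) (Def45.Carriers.ofPolDR (muOfInvType ι₁ Φ) (P F ι₁ V Φ))))
    (hLiu : ∀ (F : CMField) [IsGalois ℚ F], 6 ≤ Module.finrank ℚ F → ∀ (Φ : CMType F) (ι₁ : F →+* ℂ), ι₁ ∈ Φ.1 →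
      ∀ V : HermSpace3 F ι₁, Thm418AsPrintedC (C F ι₁ V Φ)
        (restOne (C F ι₁ V Φ) (AlgHom.id ℚ F) ι₁ (isConjugateSymplectic_muOfInvType ι₁ Φ) (hasWeight_one_muOfInvType ι₁ Φ) (Def45.Carriers.ofPolDR (muOfInvType ι₁ Φ) (P F ι₁ V Φ))
          (Eps F ι₁ V Φ) (epsOf F ι₁ V Φ) (Chi F ι₁ V Φ) (omega F ι₁ V Φ) (rho F ι₁ V Φ) (rhoΩ F ι₁ V Φ)))
    (hObj : ∀ (F : CMField) [IsGalois ℚ F], 6 ≤ Module.finrank ℚ F → ∀ (Φ : CMType F) (ι₁ : F →+* ℂ), ι₁ ∈ Φ.1 →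
      ∀ V : HermSpace3 F ι₁,
        Nonempty (Def45.CMDatum (AlgHom.id ℚ F) ι₁ (isConjugateSymplectic_muOfInvType ι₁ Φ) (hasWeight_one_muOfInvType ι₁ Φ) (Def45.Carriers.ofPolDR (muOfInvType ι₁ Φ) (P F ι₁ V Φ))))
    (hChi : ∀ (F : CMField), IsGalois ℚ F → 6 ≤ Module.finrank ℚ F → ∀ (Φ : CMType F) (ι₁ : F →+* ℂ), ι₁ ∈ Φ.1 →
      ∀ V : HermSpace3 F ι₁, Nonempty (Chi F ι₁ V Φ))
    (hirr : ∀ (F : CMField) [IsGalois ℚ F], 6 ≤ Module.finrank ℚ F → ∀ (Φ : CMType F) (ι₁ : F →+* ℂ), ι₁ ∈ Φ.1 →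
      ∀ (V : HermSpace3 F ι₁)
        (i : (toThm418Data (C F ι₁ V Φ)
          (restOne (C F ι₁ V Φ) (AlgHom.id ℚ F) ι₁ (isConjugateSymplectic_muOfInvType ι₁ Φ) (hasWeight_one_muOfInvType ι₁ Φ) (Def45.Carriers.ofPolDR (muOfInvType ι₁ Φ) (P F ι₁ V Φ))
            (Eps F ι₁ V Φ) (epsOf F ι₁ V Φ) (Chi F ι₁ V Φ) (omega F ι₁ V Φ) (rho F ι₁ V Φ) (rhoΩ F ι₁ V Φ))).AdmIndex),
        (rho F ι₁ V Φ i.1.1 i.1.2).IsIrreducible)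
    (hsm : ∀ (F : CMField) [IsGalois ℚ F], 6 ≤ Module.finrank ℚ F → ∀ (Φ : CMType F) (ι₁ : F →+* ℂ), ι₁ ∈ Φ.1 →
      ∀ (V : HermSpace3 F ι₁)
        (i : (toThm418Data (C F ι₁ V Φ)
          (restOne (C F ι₁ V Φ) (AlgHom.id ℚ F) ι₁ (isConjugateSymplectic_muOfInvType ι₁ Φ) (hasWeight_one_muOfInvType ι₁ Φ) (Def45.Carriers.ofPolDR (muOfInvType ι₁ Φ) (P F ι₁ V Φ))
            (Eps F ι₁ V Φ) (epsOf F ι₁ V Φ) (Chi F ι₁ V Φ) (omega F ι₁ V Φ) (rho F ι₁ V Φ) (rhoΩ F ι₁ V Φ))).AdmIndex)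
        (v : omega F ι₁ V Φ i.1.1 i.1.2),
        ∃ S : Subgroup (C F ι₁ V Φ).G, IsOpen (S : Set (C F ι₁ V Φ).G) ∧ ∀ k ∈ S, rho F ι₁ V Φ i.1.1 i.1.2 k v = v) :
    let U := picardCMUniverse exists_isReal_hodgeModel_holds hodgePQ_independent_of_hodgeModel_holds
      BallQuotient.ballQuotientUniformised_holds cmAbelianVarietyRealised_holds
    let hU := ballQuotientUniformisedDatum_of BallQuotient.ballQuotientUniformised_holds
    (∀ (F : CMField), IsGalois ℚ F → 6 ≤ Module.finrank ℚ F → ∀ (f : Face F) (ι₁ : F →+* ℂ), f.Admissible ι₁ →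
      ∀ V : HermSpace3 F ι₁,
      ∃ (H CG G SK SigIdx SigIdxG : Type) (_ : NormedAddCommGroup H) (_ : InnerProductSpace ℂ H) (_ : CompleteSpace H)
        (_ : NormedAddCommGroup CG) (_ : NormedSpace ℂ CG) (_ : Group G) (_ : TopologicalSpace G) (_ : TopologicalSpace SK)
        (S : Perl34.IsolationSetting H (Lp ℂ 2 V.autMeasure) CG G SK SigIdx SigIdxG),
        (∀ (Γ : Level V) (ω₁ ω₂ : U.CohC (U.pms F ι₁ V Γ) 1),
          ω₁ ∈ U.Uiso Γ F (f.psi 0) ι₁ → ω₂ ∈ U.Uiso Γ F (f.psi 1) ι₁ →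
            embOf exists_isReal_hodgeModel_holds hodgePQ_independent_of_hodgeModel_holds hU cmAbelianVarietyRealised_holds Γ
                (U.cup2C (U.pms F ι₁ V Γ) 1 ω₁ ω₂) ≠ 0 →
              ∃ u ∈ S.t12.S12,
                ⟪embOf exists_isReal_hodgeModel_holds hodgePQ_independent_of_hodgeModel_holds hU cmAbelianVarietyRealised_holds Γ
                    (U.cup2C (U.pms F ι₁ V Γ) 1 ω₁ ω₂), u⟫_ℂ ≠ 0) ∧
        (∀ χ : S.t34.X, S.t34.allowed χ → ∀ (Φ : SK) (Γ₁ : Level V)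
          (ω₁ ω₂ : U.CohC (U.pms F ι₁ V Γ₁) 1),
          ω₁ ∈ U.Uiso Γ₁ F (f.psi 0) ι₁ →
          ω₂ ∈ U.Uiso Γ₁ F (f.psi 1) ι₁ →
            ⟪embOf exists_isReal_hodgeModel_holds hodgePQ_independent_of_hodgeModel_holds hU cmAbelianVarietyRealised_holds Γ₁
                (U.cup2C (U.pms F ι₁ V Γ₁) 1 ω₁ ω₂),
              S.t34.ϑ χ Φ⟫_ℂ ≠ 0 →
              ∃ (Γ : Level V) (ω : Fin 4 → U.CohC (U.pms F ι₁ V Γ) 1),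
                (∀ i, ω i ∈ U.Uiso Γ F (f.psi i) ι₁) ∧
                  ⟪embOf exists_isReal_hodgeModel_holds hodgePQ_independent_of_hodgeModel_holds hU cmAbelianVarietyRealised_holds Γ
                      (U.cup2C (U.pms F ι₁ V Γ) 1 (ω 2) (ω 3)),
                    embOf exists_isReal_hodgeModel_holds hodgePQ_independent_of_hodgeModel_holds hU cmAbelianVarietyRealised_holds Γ
                      (U.cup2C (U.pms F ι₁ V Γ) 1 (ω 0) (ω 1))⟫_ℂ
                    ≠ 0)) →
    HC_CM :=
  fun hM ↦ hc_cm_of_supply_of_settingMeetSat_embOf exists_isReal_hodgeModel_holds hodgePQ_independent_of_hodgeModel_holds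
    BallQuotient.ballQuotientUniformised_holds cmAbelianVarietyRealised_holds deligneMilne1982_Thm_6_20_full_holds
    (faceSupply_of_thm418AsPrinted_along_conj_holds_restOne _ _ _ _ h hA iso C P Eps epsOf Chi omega rho rhoΩ hLiu hObj hChi hirr hsm) hM

end MeetingForm

end Summit.HodgeConjecture.CorCM.Model

end
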